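import Summits.Ventures.HodgeRepro.TwoPowerTimesTwoNoSingleClass

/-!
# The family `(C_{2^(a+1)} × C₂, (2^a, 0))` on the kernel, and its first members

Blind re-derivation cell `pub-hodge-repro`, seat `p1` (gen 11).  The abstract theorem
`exists_conj_of_sumTwo_kleinPair` of `TwoPowerTimesTwoNoSingleClass.lean` is instantiated on the typer's
`Multiplicative (ZMod N × ZMod 2)`, `N = 2 · 2^a`, with complex conjugation `c = (2^a, 0)`:

* `projFst : (x, y) ↦ x` and `projSnd : (x, y) ↦ x + 2^a · y` are the two surjections onto `ℤ/N`, with kernels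
  `{1, (0, 1)}` and `{1, (2^a, 1)}`, and `(2^a, 1) = (0, 1) · c`;
* `exists_conj_of_sumTwo_twoPowerTimesTwo` — every `SumTwo` quadruple of Galois twists of a CM type of
  `(C_{2^(a+1)} × C₂, (2^a, 0))` has two complex-conjugate corners, for EVERY `a`;
* `not_isSingleClass_twoPowerTimesTwo` — the same in the shape of the census rows (`QuadFinset12`);
* the members `a = 1, …, 5`: `C₄ × C₂` (the typer's `cc_C4xC2_sq`), `C₈ × C₂`, `C₁₆ × C₂`, `C₃₂ × C₂`
  (the UNDECIDED case of the gen-10 census job j160088) and `C₆₄ × C₂`.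
-/

set_option autoImplicit false

open Finset Function
open scoped Pointwise

namespace HodgeRepro.TwoPowerTimesTwo

variable {N : ℕ} [NeZero N]

/-! ### The two surjections `C_N × C₂ →* C_N` -/

/-- The first projection `(x, y) ↦ x`. -/
def projFst (N : ℕ) : Multiplicative (ZMod N × ZMod 2) →* Multiplicative (ZMod N) :=
  AddMonoidHom.toMultiplicative (AddMonoidHom.fst (ZMod N) (ZMod 2))

/-- The additive map `ℤ/2 → ℤ/N` sending `1` to `m`, for `m + m = 0`. -/
def halfMap (m : ℕ) (hm : (m : ZMod N) + m = 0) : ZMod 2 →+ ZMod N :=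
  AddMonoidHom.mk' (fun y => if y = 0 then 0 else (m : ZMod N)) (by
    intro y₁ y₂
    have hy : ∀ y : ZMod 2, y = 0 ∨ y = 1 := by decide
    rcases hy y₁ with rfl | rfl <;> rcases hy y₂ with rfl | rfl
    · simp
    · simp
    · simp
    · have h11 : (1 : ZMod 2) + 1 = 0 := by decide
      rw [h11, if_pos rfl, if_neg one_ne_zero, hm])

/-- The second surjection `(x, y) ↦ x + m y` (`m = N/2`). -/
def projSnd (m : ℕ) (hm : (m : ZMod N) + m = 0) :
    Multiplicative (ZMod N × ZMod 2) →* Multiplicative (ZMod N) :=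
  AddMonoidHom.toMultiplicative
    (AddMonoidHom.fst (ZMod N) (ZMod 2) + (halfMap m hm).comp (AddMonoidHom.snd (ZMod N) (ZMod 2)))

omit [NeZero N] in
/-- `projFst (x, y) = x`. -/
theorem projFst_apply (x : ZMod N) (y : ZMod 2) :
    projFst N (Multiplicative.ofAdd (x, y)) = Multiplicative.ofAdd x := rfl

omit [NeZero N] in
/-- `projSnd (x, y) = x + m y`. -/
theorem projSnd_apply (m : ℕ) (hm : (m : ZMod N) + m = 0) (x : ZMod N) (y : ZMod 2) :
    projSnd m hm (Multiplicative.ofAdd (x, y)) =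
      Multiplicative.ofAdd (x + if y = 0 then 0 else (m : ZMod N)) := rfl

/-! ### The family -/

/-- **`C_{2^(a+1)} × C₂` with `c = (2^a, 0)`.**  Every `SumTwo` quadruple of Galois twists of a CM type has two
complex-conjugate corners. -/
theorem exists_conj_of_sumTwo_twoPowerTimesTwo {a : ℕ} (hN : N = 2 * 2 ^ a)
    (Φ : Finset (Multiplicative (ZMod N × ZMod 2)))
    (hΦ : IsCMType (Multiplicative.ofAdd (((2 ^ a : ℕ) : ZMod N), (0 : ZMod 2))) Φ)
    (g : Fin 4 → Multiplicative (ZMod N × ZMod 2)) (hs : SumTwo (fun i => rmul Φ (g i))) :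
    ∃ i j : Fin 4, rmul Φ (g j) =
      Multiplicative.ofAdd (((2 ^ a : ℕ) : ZMod N), (0 : ZMod 2)) • rmul Φ (g i) := by
  have hm : ((2 ^ a : ℕ) : ZMod N) + ((2 ^ a : ℕ) : ZMod N) = 0 := by
    rw [← Nat.cast_add, ← two_mul, ← hN, ZMod.natCast_self]
  have hm0 : ((2 ^ a : ℕ) : ZMod N) ≠ 0 := CyclicQuad.natCast_half_ne_zero hN
  have hneg : -((2 ^ a : ℕ) : ZMod N) = ((2 ^ a : ℕ) : ZMod N) := neg_eq_of_add_eq_zero_right hm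
  have hy : ∀ y : ZMod 2, y = 0 ∨ y = 1 := by decide
  have h10 : ¬ ((1 : ZMod 2) = 0) := by decide
  have hc : IsComplexConj (Multiplicative.ofAdd (((2 ^ a : ℕ) : ZMod N), (0 : ZMod 2))) := by
    refine ⟨?_, ?_, fun g => mul_comm _ g⟩
    · intro h
      rw [ofAdd_eq_one, Prod.mk_eq_zero] at h
      exact hm0 h.1
    · rw [← ofAdd_add, Prod.mk_add_mk, hm, add_zero]; exact ofAdd_eq_one.mpr rfl
  have hφ₀ : Surjective (projFst N) := fun x =>
    ⟨Multiplicative.ofAdd (Multiplicative.toAdd x, 0), by rw [projFst_apply, ofAdd_toAdd]⟩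
  have hφ₁ : Surjective (projSnd (2 ^ a) hm) := fun x =>
    ⟨Multiplicative.ofAdd (Multiplicative.toAdd x, 0), by
      rw [projSnd_apply, if_pos rfl, add_zero, ofAdd_toAdd]⟩
  have hc₀ : projFst N (Multiplicative.ofAdd (((2 ^ a : ℕ) : ZMod N), (0 : ZMod 2))) =
      Multiplicative.ofAdd ((2 ^ a : ℕ) : ZMod N) := rfl
  have hc₁ : projSnd (2 ^ a) hm (Multiplicative.ofAdd (((2 ^ a : ℕ) : ZMod N), (0 : ZMod 2))) =
      Multiplicative.ofAdd ((2 ^ a : ℕ) : ZMod N) := by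
    rw [projSnd_apply, if_pos rfl, add_zero]
  have hk₀ : ∀ z, projFst N z = 1 ↔ z = 1 ∨ z = Multiplicative.ofAdd ((0 : ZMod N), (1 : ZMod 2)) := by
    intro z
    obtain ⟨⟨x, y⟩, rfl⟩ := Multiplicative.ofAdd.surjective z
    rw [projFst_apply, ofAdd_eq_one, ofAdd_eq_one, Multiplicative.ofAdd.injective.eq_iff,
      Prod.mk_eq_zero, Prod.mk.injEq]
    constructor
    · intro hx
      rcases hy y with rfl | rfl
      · exact Or.inl ⟨hx, rfl⟩
      · exact Or.inr ⟨hx, rfl⟩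
    · rintro (⟨hx, _⟩ | ⟨hx, _⟩) <;> exact hx
  have hk₁ : ∀ z, projSnd (2 ^ a) hm z = 1 ↔
      z = 1 ∨ z = Multiplicative.ofAdd (((2 ^ a : ℕ) : ZMod N), (1 : ZMod 2)) := by
    intro z
    obtain ⟨⟨x, y⟩, rfl⟩ := Multiplicative.ofAdd.surjective z
    rw [projSnd_apply, ofAdd_eq_one, ofAdd_eq_one, Multiplicative.ofAdd.injective.eq_iff,
      Prod.mk_eq_zero, Prod.mk.injEq]
    rcases hy y with rfl | rfl
    · rw [if_pos rfl, add_zero]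
      constructor
      · intro hx; exact Or.inl ⟨hx, rfl⟩
      · rintro (⟨hx, _⟩ | ⟨_, h⟩)
        · exact hx
        · exact absurd h.symm h10
    · rw [if_neg h10]
      constructor
      · intro hx
        refine Or.inr ⟨?_, rfl⟩
        rw [← hneg]; exact eq_neg_of_add_eq_zero_left hx
      · rintro (⟨_, h⟩ | ⟨hx, _⟩)
        · exact absurd h h10
        · rw [hx, hm]
  have hκ₀ : Multiplicative.ofAdd ((0 : ZMod N), (1 : ZMod 2)) ≠ 1 := by
    rw [Ne, ofAdd_eq_one, Prod.mk_eq_zero]; exact fun h => h10 h.2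
  have hκ₁ : Multiplicative.ofAdd (((2 ^ a : ℕ) : ZMod N), (1 : ZMod 2)) ≠ 1 := by
    rw [Ne, ofAdd_eq_one, Prod.mk_eq_zero]; exact fun h => h10 h.2
  have hκ : Multiplicative.ofAdd (((2 ^ a : ℕ) : ZMod N), (1 : ZMod 2)) =
      Multiplicative.ofAdd ((0 : ZMod N), (1 : ZMod 2)) *
        Multiplicative.ofAdd (((2 ^ a : ℕ) : ZMod N), (0 : ZMod 2)) := by
    rw [← ofAdd_add, Prod.mk_add_mk, zero_add, add_zero]
  exact exists_conj_of_sumTwo_kleinPair hN hc (projFst N) (projSnd (2 ^ a) hm) hφ₀ hφ₁ hc₀ hc₁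
    hk₀ hk₁ hκ₀ hκ₁ hκ Φ hΦ g hs

/-- **Corollary in the shape of `QuadFinset12`'s `not_isSingleClass_<G>`**: on `C_{2^(a+1)} × C₂` with
`c = (2^a, 0)` no single-class `SumTwo` quadruple of CM types without a conjugate pair exists. -/
theorem not_isSingleClass_twoPowerTimesTwo {a : ℕ} (hN : N = 2 * 2 ^ a)
    (T : Fin 4 → Finset (Multiplicative (ZMod N × ZMod 2)))
    (hT : IsCMType (Multiplicative.ofAdd (((2 ^ a : ℕ) : ZMod N), (0 : ZMod 2))) (T 0)) (hs : SumTwo T)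
    (hnc : ∀ i j : Fin 4, T j ≠ Multiplicative.ofAdd (((2 ^ a : ℕ) : ZMod N), (0 : ZMod 2)) • T i) :
    ¬ IsSingleClass T := by
  intro hsc
  choose g hg using hsc
  have hT' : T = fun i => rmul (T 0) (g i) := funext hg
  have hs' : SumTwo (fun i => rmul (T 0) (g i)) := by rw [← hT']; exact hs
  obtain ⟨i, j, hij⟩ := exists_conj_of_sumTwo_twoPowerTimesTwo hN (T 0) hT g hs'
  exact hnc i j (by rw [hg j, hg i]; exact hij)

/-! ### The first members: `C₄ × C₂`, `C₈ × C₂`, `C₁₆ × C₂`, `C₃₂ × C₂`, `C₆₄ × C₂` -/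

/-- The typer's `cc_C4xC2_sq = ofAdd (2, 0)` is `ofAdd (2^1, 0)`. -/
theorem cc_C4xC2_sq_eq :
    cc_C4xC2_sq = Multiplicative.ofAdd (((2 ^ 1 : ℕ) : ZMod 4), (0 : ZMod 2)) := by decide

/-- `(C₄ × C₂, (2, 0))` (the typer's `cc_C4xC2_sq`): no single-class `SumTwo` quadruple without a conjugate
pair. -/
theorem not_isSingleClass_C4xC2_sq (T : Fin 4 → Finset C4xC2) (hT : IsCMType cc_C4xC2_sq (T 0))
    (hs : SumTwo T) (hnc : ∀ i j : Fin 4, T j ≠ cc_C4xC2_sq • T i) : ¬ IsSingleClass T := by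
  rw [cc_C4xC2_sq_eq] at hT hnc
  exact not_isSingleClass_twoPowerTimesTwo (a := 1) (by norm_num) T hT hs hnc

/-- `C₈ × C₂`. -/
abbrev C8xC2 : Type := Multiplicative (ZMod 8 × ZMod 2)

/-- `(C₈ × C₂, (4, 0))`: no single-class `SumTwo` quadruple without a conjugate pair (census EMPTY, gen 6). -/
theorem not_isSingleClass_C8xC2 (T : Fin 4 → Finset C8xC2)
    (hT : IsCMType (Multiplicative.ofAdd (((2 ^ 2 : ℕ) : ZMod 8), (0 : ZMod 2))) (T 0)) (hs : SumTwo T)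
    (hnc : ∀ i j : Fin 4, T j ≠ Multiplicative.ofAdd (((2 ^ 2 : ℕ) : ZMod 8), (0 : ZMod 2)) • T i) :
    ¬ IsSingleClass T :=
  not_isSingleClass_twoPowerTimesTwo (a := 2) (by norm_num) T hT hs hnc

/-- `C₁₆ × C₂`. -/
abbrev C16xC2 : Type := Multiplicative (ZMod 16 × ZMod 2)

/-- `(C₁₆ × C₂, (8, 0))`: no single-class `SumTwo` quadruple without a conjugate pair (census EMPTY, gen 10). -/
theorem not_isSingleClass_C16xC2 (T : Fin 4 → Finset C16xC2)
    (hT : IsCMType (Multiplicative.ofAdd (((2 ^ 3 : ℕ) : ZMod 16), (0 : ZMod 2))) (T 0)) (hs : SumTwo T)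
    (hnc : ∀ i j : Fin 4, T j ≠ Multiplicative.ofAdd (((2 ^ 3 : ℕ) : ZMod 16), (0 : ZMod 2)) • T i) :
    ¬ IsSingleClass T :=
  not_isSingleClass_twoPowerTimesTwo (a := 3) (by norm_num) T hT hs hnc

/-- `C₃₂ × C₂`. -/
abbrev C32xC2 : Type := Multiplicative (ZMod 32 × ZMod 2)

/-- `(C₃₂ × C₂, (16, 0))`: no single-class `SumTwo` quadruple without a conjugate pair — the case the gen-10
census job j160088 left UNDECIDED (30 of 9,952 pointed `4`-sets hit its solution cap). -/
theorem not_isSingleClass_C32xC2 (T : Fin 4 → Finset C32xC2)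
    (hT : IsCMType (Multiplicative.ofAdd (((2 ^ 4 : ℕ) : ZMod 32), (0 : ZMod 2))) (T 0)) (hs : SumTwo T)
    (hnc : ∀ i j : Fin 4, T j ≠ Multiplicative.ofAdd (((2 ^ 4 : ℕ) : ZMod 32), (0 : ZMod 2)) • T i) :
    ¬ IsSingleClass T :=
  not_isSingleClass_twoPowerTimesTwo (a := 4) (by norm_num) T hT hs hnc

/-- `C₆₄ × C₂`. -/
abbrev C64xC2 : Type := Multiplicative (ZMod 64 × ZMod 2)

/-- `(C₆₄ × C₂, (32, 0))`: no single-class `SumTwo` quadruple without a conjugate pair (beyond the census). -/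
theorem not_isSingleClass_C64xC2 (T : Fin 4 → Finset C64xC2)
    (hT : IsCMType (Multiplicative.ofAdd (((2 ^ 5 : ℕ) : ZMod 64), (0 : ZMod 2))) (T 0)) (hs : SumTwo T)
    (hnc : ∀ i j : Fin 4, T j ≠ Multiplicative.ofAdd (((2 ^ 5 : ℕ) : ZMod 64), (0 : ZMod 2)) • T i) :
    ¬ IsSingleClass T :=
  not_isSingleClass_twoPowerTimesTwo (a := 5) (by norm_num) T hT hs hnc

end HodgeRepro.TwoPowerTimesTwo
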